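import Mathlib
import Summits.MatrixMultiplication.Statement
import Summits.MatrixMultiplication.MatrixMultiplication.Theses.WindowedCompletionRank
import Summits.MatrixMultiplication.MatrixMultiplication.Theorems.WindowedCompletionRankWeylPresentation
import Summits.MatrixMultiplication.MatrixMultiplication.Theorems.WindowedCompletionRankWeylToThesis

/-!
# Crux `Thesis` (stmt-MatrixMultiplication-5491) — ALTERNATIVE line `toric-border` (strategist s2)

Route `WindowedCompletionRank`, crux #0 `Thesis`. This is a strategist's ALTERNATIVE skeleton,
registered alongside (never over) the lead's live line `Lines/birth_WindowedCompletionRank.lean`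
(stubs `stub_weylSeed` LANDED p171230, `stub_kroneckerLadder` LANDED p146897, `stub_amplify` OPEN).

## Why another line
After the two landings the live line's only open stub `stub_amplify` is `WeylCompletion`
(crux #2, stmt-5492) with a hypothesis that is now a theorem: "some seed `θ < 1` at all levels ⟹
`θ → 0`". Kronecker powers keep the Weyl-frame exponent `θ = log_{m^k} c` constant; no
amplification mechanism exists (lead HANDOFF; route header "SecondGain": all known gains are
delegation, i.e. recursion). The stuck goal is therefore not a lemma but a missing CONSTRUCTION of
completions with `θ → 0`.

## The lever: border (graph-approximate) completions and their tropical skeleton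
Replace EXACT completions of the clock-and-shift cocycle `ζ_m^{g₂·h₁}` by BORDER completions:
`c` triples of polynomial-valued functions `u_i v_i w_i : G → ℂ[X]` (`G = (ℤ_m^k)²`) with
`Σ_i u_i(g+h) v_i(g) w_i(h) = X^d·ζ_m^{g₂·h₁} + O(X^{d+1})` on the graph only. Because every free
Heisenberg orbit of rank-one tensors spans a tensor of rank exactly `|G|`, the whole analytic part of
border rank disappears in this frame: a border completion is a purely COMBINATORIAL-PLUS-LINEAR
object on `G²` — its valuation data `a_i = ord u_i, b_i = ord v_i, e_i = ord w_i : G → ℕ` are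
"corner functions" `s_i(g,h) = a_i(g+h) + b_i(g) + e_i(h) ≥ d` whose equality cells cover `G²`,
and on the cells the leading phases `p_i q_i r_i` must sum to the cocycle (STUB 1, the heart:
TROPICAL CORNER COVERS WITH PHASES — the Bini/Schönhage/Coppersmith–Winograd class, i.e. one
monomial per coordinate, made `G`-equivariant). STUB 2 lifts a cover to a polynomial family
(monomials `p·X^a`), STUB 3 is Bini's interpolation INSIDE the frame (Kronecker powers of a
graph-approximate family are graph-approximate of order `jd` because the cocycle is multiplicative
over blocks; the `X^{jd}`-coefficient tensor is an EXACT completion of rank `≤ C(jd+2,2)·c^j` —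
the proof of `tensorRank_le_choose_mul_of_isApproxDecomposition` verbatim with `t :=` the
coefficient tensor), STUB 4 is the exponent budget (`C(jd+2,2)` is polynomial in `j`, `m^{δkj/2}`
exponential), landing in `WeylCompletion`; the landed presentation + glue give `Thesis` BY NAME.

Exact completions are the `d = 0` covers, so STUB 1 is implied by `WeylCompletion` (no extra risk)
while its solution space at each finite level is strictly larger (border ⊋ exact: `bR⟨2,2,3⟩ = 10 <
11`, `bR⟨3⟩ ≤ 20 < 23`), discrete in its exponent part and trilinear-sparse in its phase part —
searchable by SAT/MILP + linear algebra rather than by Levenberg–Marquardt + exactification, and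
the historical source of EVERY exponent below 2.78 (Bini, Schönhage, CW are hand-found valuation
patterns). First rungs are tied to OPEN border-rank values: a cover with `(m,k,c) = (3,1,2)` is a
Heisenberg-symmetric border identity `bR⟨3,3,3⟩ ≤ 18 ∈ [17,20]`; `(2,2,2)`/`(4,1,2)` would give
`bR⟨4,4,4⟩ ≤ 32` (lower bound 29); `(5,1,4)`, `(2,2,3)`, `(4,1,3)` are the levels where the
lead's exact search found nothing. Strategist job j027787 (LM on the order-`d` polynomial system,
`d ≤ 3`, 17 cases incl. calibrations) is the cheapest falsifier of "border beats exact somewhere".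

Disproof used: none exists for this crux (`ledger crux ls`, 2026-08-17). Landed negatives
(`Theorems/Thesis/Negative/WindowedCompletionRank{NoSingleLevel,ForcedInjectivity}`) concern the
frame (`|G| = n²`, bijective index maps, `δ → 0` quantified inside) and are honoured verbatim: the
line changes only HOW completions are produced, not the frame.
-/

set_option linter.dupNamespace false

namespace Summit.MatrixMultiplication.MatrixMultiplication.Cruxes.Thesis.ToricBorderWCR

open Polynomial
open Summit.MatrixMultiplication.MatrixMultiplication.Theses.WindowedCompletionRank
open Summit.MatrixMultiplication.MatrixMultiplication.Theorems

/-- STUB 1 — TROPICAL CORNER COVERS WITH PHASES (OPEN; the heart, `ω = 2`-strength like every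
residual of this crux, but implied by `WeylCompletion` via `d = 0`): for every `δ > 0` some level
`(m,k)`, an order `d` and `c ≤ m^(δk)` triples of exponent functions `a_i b_i e_i : G → ℕ` and phase
functions `p_i q_i r_i : G → ℂ` on `G = (ℤ_m^k)²` such that every corner sum
`a_i(g+h) + b_i(g) + e_i(h)` is `≥ d` and, summing the phase products over the indices where it
equals `d`, one gets the cocycle `exp(2πi (g₂·h₁)/m)` at every `(g,h)`. -/
theorem stub_tropicalCoverFamily :
    ∀ δ : ℝ, 0 < δ → ∃ m : ℕ, 2 ≤ m ∧ ∃ k : ℕ, 1 ≤ k ∧ ∃ d c : ℕ, (c : ℝ) ≤ (m : ℝ) ^ (δ * k) ∧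
      ∃ (a b e : Fin c → ((Fin k → ZMod m) × (Fin k → ZMod m)) → ℕ)
        (p q r : Fin c → ((Fin k → ZMod m) × (Fin k → ZMod m)) → ℂ),
        (∀ i, ∀ g h : (Fin k → ZMod m) × (Fin k → ZMod m), d ≤ a i (g + h) + b i g + e i h) ∧
        (∀ g h : (Fin k → ZMod m) × (Fin k → ZMod m),
          (∑ i, if a i (g + h) + b i g + e i h = d then p i (g + h) * q i g * r i h else 0) =
            Complex.exp (2 * Real.pi * Complex.I * ((∑ i, g.2 i * h.1 i).val : ℂ) / m)) := by
  sorry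

/-- STUB 2 — TORIC LIFT (provable, M): a tropical corner cover with phases is a graph-approximate
polynomial family of the same order and length: put `u_i(g) := C (p_i g) * X^(a_i g)`,
`v_i := C q_i * X^(b_i)`, `w_i := C r_i * X^(e_i)`; the `X^j`-coefficient of
`Σ_i u_i(g+h) v_i(g) w_i(h)` is the phase sum over `{i | a_i(g+h)+b_i(g)+e_i(h) = j}`, empty for
`j < d` and the cover's cell sum for `j = d` (`Polynomial.coeff_C_mul_X_pow`, `finsetSum_coeff`). -/
theorem stub_toricLift :
    ∀ (m k d c : ℕ) (a b e : Fin c → ((Fin k → ZMod m) × (Fin k → ZMod m)) → ℕ)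
      (p q r : Fin c → ((Fin k → ZMod m) × (Fin k → ZMod m)) → ℂ),
      (∀ i, ∀ g h : (Fin k → ZMod m) × (Fin k → ZMod m), d ≤ a i (g + h) + b i g + e i h) →
      (∀ g h : (Fin k → ZMod m) × (Fin k → ZMod m),
        (∑ i, if a i (g + h) + b i g + e i h = d then p i (g + h) * q i g * r i h else 0) =
          Complex.exp (2 * Real.pi * Complex.I * ((∑ i, g.2 i * h.1 i).val : ℂ) / m)) →
      ∃ (u v w : Fin c → ((Fin k → ZMod m) × (Fin k → ZMod m)) → Polynomial ℂ),
        ∀ g h : (Fin k → ZMod m) × (Fin k → ZMod m), ∀ j : ℕ, j ≤ d →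
          (∑ i, u i (g + h) * v i g * w i h).coeff j =
            if j = d then Complex.exp (2 * Real.pi * Complex.I * ((∑ i, g.2 i * h.1 i).val : ℂ) / m)
            else 0 := by
  sorry

/-- STUB 3 — FINITE BORDER LADDER (provable, L; Bini 1980 inside the Weyl frame): a
graph-approximate family of order `d` with `c` terms at level `k` yields, for every `j`, an EXACT
completion of the cocycle at level `j*k` of rank `≤ C(jd+2,2)·c^j`. Proof plan: the `j`-fold block
product of the family (blocks `Fin (j*k) ≃ Fin j × Fin k` as in the landed
`Theorems.Thesis.stub_kroneckerLadder`, products taken in `ℂ[X]`) is graph-approximate of order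
`j*d` for the level-`j*k` cocycle (the cocycle is multiplicative over blocks — `exp_val_sum_eq_prod`
of that file — and the lowest coefficient of a product is the product of lowest coefficients); the
`X^(j*d)`-coefficient tensor, taken at ALL entries, is the completion, and its rank bound is the
sigma-antidiagonal count in the proof of `tensorRank_le_choose_mul_of_isApproxDecomposition`
(which uses only the degree-`h` identity). `j = 0` is the one-point level (rank `1 ≤ 1`). -/
theorem stub_finiteBorderLadder :
    ∀ (m k d c : ℕ), 2 ≤ m →
      (∃ (u v w : Fin c → ((Fin k → ZMod m) × (Fin k → ZMod m)) → Polynomial ℂ),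
        ∀ g h : (Fin k → ZMod m) × (Fin k → ZMod m), ∀ j : ℕ, j ≤ d →
          (∑ i, u i (g + h) * v i g * w i h).coeff j =
            if j = d then Complex.exp (2 * Real.pi * Complex.I * ((∑ i, g.2 i * h.1 i).val : ℂ) / m)
            else 0) →
      ∀ j : ℕ,
        ∃ S : ((Fin (j * k) → ZMod m) × (Fin (j * k) → ZMod m)) →
            ((Fin (j * k) → ZMod m) × (Fin (j * k) → ZMod m)) →
            ((Fin (j * k) → ZMod m) × (Fin (j * k) → ZMod m)) → ℂ,
          (∀ g h : (Fin (j * k) → ZMod m) × (Fin (j * k) → ZMod m),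
            S (g + h) g h = Complex.exp (2 * Real.pi * Complex.I * ((∑ i, g.2 i * h.1 i).val : ℂ) / m)) ∧
          Literature.Computability.AlgebraicComplexity.tensorRank S ≤ (j * d + 2).choose 2 * c ^ j := by
  sorry

/-- STUB 4 — EXPONENT BUDGET (provable, M; real analysis only): border families with `c ≤ m^(δk)`
for every `δ > 0`, fed through the finite ladder, give the Weyl completion family: for target `δ`
take the family at `δ/2` and a power `j ≥ 1` with `C(jd+2,2) ≤ m^((δ/2)·k·j)` (a polynomial in `j`
against an exponential with base `m^((δ/2)k) > 1`), so that the level-`jk` completion has rank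
`≤ m^(δ·(jk))`. -/
theorem stub_exponentBudget :
    (∀ δ : ℝ, 0 < δ → ∃ m : ℕ, 2 ≤ m ∧ ∃ k : ℕ, 1 ≤ k ∧ ∃ d c : ℕ, (c : ℝ) ≤ (m : ℝ) ^ (δ * k) ∧
      ∃ (u v w : Fin c → ((Fin k → ZMod m) × (Fin k → ZMod m)) → Polynomial ℂ),
        ∀ g h : (Fin k → ZMod m) × (Fin k → ZMod m), ∀ j : ℕ, j ≤ d →
          (∑ i, u i (g + h) * v i g * w i h).coeff j =
            if j = d then Complex.exp (2 * Real.pi * Complex.I * ((∑ i, g.2 i * h.1 i).val : ℂ) / m)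
            else 0) →
    (∀ (m k d c : ℕ), 2 ≤ m →
      (∃ (u v w : Fin c → ((Fin k → ZMod m) × (Fin k → ZMod m)) → Polynomial ℂ),
        ∀ g h : (Fin k → ZMod m) × (Fin k → ZMod m), ∀ j : ℕ, j ≤ d →
          (∑ i, u i (g + h) * v i g * w i h).coeff j =
            if j = d then Complex.exp (2 * Real.pi * Complex.I * ((∑ i, g.2 i * h.1 i).val : ℂ) / m)
            else 0) →
      ∀ j : ℕ,
        ∃ S : ((Fin (j * k) → ZMod m) × (Fin (j * k) → ZMod m)) →
            ((Fin (j * k) → ZMod m) × (Fin (j * k) → ZMod m)) →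
            ((Fin (j * k) → ZMod m) × (Fin (j * k) → ZMod m)) → ℂ,
          (∀ g h : (Fin (j * k) → ZMod m) × (Fin (j * k) → ZMod m),
            S (g + h) g h = Complex.exp (2 * Real.pi * Complex.I * ((∑ i, g.2 i * h.1 i).val : ℂ) / m)) ∧
          Literature.Computability.AlgebraicComplexity.tensorRank S ≤ (j * d + 2).choose 2 * c ^ j) →
    Summit.MatrixMultiplication.MatrixMultiplication.Theses.WindowedCompletionRank.WeylCompletion := by
  sorry

/-- COMPOSITION (real proof, no `sorry` of its own): the four stub SIGNATURES imply the crux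
`Thesis` BY NAME. A tropical cover family (STUB 1) lifts level by level to a border family
(STUB 2); the exponent budget (STUB 4) runs it through the finite border ladder (STUB 3) into
`WeylCompletion`; the landed clock-and-shift presentation `weylPresentation_proof` (stmt-5498) and
the landed Weyl glue `weylToThesis_proof` (stmt-5499) turn that family into `Thesis`. -/
theorem Thesis_of :
    (∀ δ : ℝ, 0 < δ → ∃ m : ℕ, 2 ≤ m ∧ ∃ k : ℕ, 1 ≤ k ∧ ∃ d c : ℕ, (c : ℝ) ≤ (m : ℝ) ^ (δ * k) ∧
      ∃ (a b e : Fin c → ((Fin k → ZMod m) × (Fin k → ZMod m)) → ℕ)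
        (p q r : Fin c → ((Fin k → ZMod m) × (Fin k → ZMod m)) → ℂ),
        (∀ i, ∀ g h : (Fin k → ZMod m) × (Fin k → ZMod m), d ≤ a i (g + h) + b i g + e i h) ∧
        (∀ g h : (Fin k → ZMod m) × (Fin k → ZMod m),
          (∑ i, if a i (g + h) + b i g + e i h = d then p i (g + h) * q i g * r i h else 0) =
            Complex.exp (2 * Real.pi * Complex.I * ((∑ i, g.2 i * h.1 i).val : ℂ) / m))) →
    (∀ (m k d c : ℕ) (a b e : Fin c → ((Fin k → ZMod m) × (Fin k → ZMod m)) → ℕ)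
      (p q r : Fin c → ((Fin k → ZMod m) × (Fin k → ZMod m)) → ℂ),
      (∀ i, ∀ g h : (Fin k → ZMod m) × (Fin k → ZMod m), d ≤ a i (g + h) + b i g + e i h) →
      (∀ g h : (Fin k → ZMod m) × (Fin k → ZMod m),
        (∑ i, if a i (g + h) + b i g + e i h = d then p i (g + h) * q i g * r i h else 0) =
          Complex.exp (2 * Real.pi * Complex.I * ((∑ i, g.2 i * h.1 i).val : ℂ) / m)) →
      ∃ (u v w : Fin c → ((Fin k → ZMod m) × (Fin k → ZMod m)) → Polynomial ℂ),
        ∀ g h : (Fin k → ZMod m) × (Fin k → ZMod m), ∀ j : ℕ, j ≤ d →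
          (∑ i, u i (g + h) * v i g * w i h).coeff j =
            if j = d then Complex.exp (2 * Real.pi * Complex.I * ((∑ i, g.2 i * h.1 i).val : ℂ) / m)
            else 0) →
    (∀ (m k d c : ℕ), 2 ≤ m →
      (∃ (u v w : Fin c → ((Fin k → ZMod m) × (Fin k → ZMod m)) → Polynomial ℂ),
        ∀ g h : (Fin k → ZMod m) × (Fin k → ZMod m), ∀ j : ℕ, j ≤ d →
          (∑ i, u i (g + h) * v i g * w i h).coeff j =
            if j = d then Complex.exp (2 * Real.pi * Complex.I * ((∑ i, g.2 i * h.1 i).val : ℂ) / m)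
            else 0) →
      ∀ j : ℕ,
        ∃ S : ((Fin (j * k) → ZMod m) × (Fin (j * k) → ZMod m)) →
            ((Fin (j * k) → ZMod m) × (Fin (j * k) → ZMod m)) →
            ((Fin (j * k) → ZMod m) × (Fin (j * k) → ZMod m)) → ℂ,
          (∀ g h : (Fin (j * k) → ZMod m) × (Fin (j * k) → ZMod m),
            S (g + h) g h = Complex.exp (2 * Real.pi * Complex.I * ((∑ i, g.2 i * h.1 i).val : ℂ) / m)) ∧
          Literature.Computability.AlgebraicComplexity.tensorRank S ≤ (j * d + 2).choose 2 * c ^ j) →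
    ((∀ δ : ℝ, 0 < δ → ∃ m : ℕ, 2 ≤ m ∧ ∃ k : ℕ, 1 ≤ k ∧ ∃ d c : ℕ, (c : ℝ) ≤ (m : ℝ) ^ (δ * k) ∧
        ∃ (u v w : Fin c → ((Fin k → ZMod m) × (Fin k → ZMod m)) → Polynomial ℂ),
          ∀ g h : (Fin k → ZMod m) × (Fin k → ZMod m), ∀ j : ℕ, j ≤ d →
            (∑ i, u i (g + h) * v i g * w i h).coeff j =
              if j = d then Complex.exp (2 * Real.pi * Complex.I * ((∑ i, g.2 i * h.1 i).val : ℂ) / m)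
              else 0) →
      (∀ (m k d c : ℕ), 2 ≤ m →
        (∃ (u v w : Fin c → ((Fin k → ZMod m) × (Fin k → ZMod m)) → Polynomial ℂ),
          ∀ g h : (Fin k → ZMod m) × (Fin k → ZMod m), ∀ j : ℕ, j ≤ d →
            (∑ i, u i (g + h) * v i g * w i h).coeff j =
              if j = d then Complex.exp (2 * Real.pi * Complex.I * ((∑ i, g.2 i * h.1 i).val : ℂ) / m)
              else 0) →
        ∀ j : ℕ,
          ∃ S : ((Fin (j * k) → ZMod m) × (Fin (j * k) → ZMod m)) →
              ((Fin (j * k) → ZMod m) × (Fin (j * k) → ZMod m)) →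
              ((Fin (j * k) → ZMod m) × (Fin (j * k) → ZMod m)) → ℂ,
            (∀ g h : (Fin (j * k) → ZMod m) × (Fin (j * k) → ZMod m),
              S (g + h) g h = Complex.exp (2 * Real.pi * Complex.I * ((∑ i, g.2 i * h.1 i).val : ℂ) / m)) ∧
            Literature.Computability.AlgebraicComplexity.tensorRank S ≤ (j * d + 2).choose 2 * c ^ j) →
      Summit.MatrixMultiplication.MatrixMultiplication.Theses.WindowedCompletionRank.WeylCompletion) →
    Summit.MatrixMultiplication.MatrixMultiplication.Theses.WindowedCompletionRank.Thesis := by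
  intro hCover hLift hLadder hBudget
  -- border families at every rate, from the tropical covers through the toric lift
  have hBorder : ∀ δ : ℝ, 0 < δ → ∃ m : ℕ, 2 ≤ m ∧ ∃ k : ℕ, 1 ≤ k ∧ ∃ d c : ℕ,
      (c : ℝ) ≤ (m : ℝ) ^ (δ * k) ∧
      ∃ (u v w : Fin c → ((Fin k → ZMod m) × (Fin k → ZMod m)) → Polynomial ℂ),
        ∀ g h : (Fin k → ZMod m) × (Fin k → ZMod m), ∀ j : ℕ, j ≤ d →
          (∑ i, u i (g + h) * v i g * w i h).coeff j =
            if j = d then Complex.exp (2 * Real.pi * Complex.I * ((∑ i, g.2 i * h.1 i).val : ℂ) / m)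
            else 0 := by
    intro δ hδ
    obtain ⟨m, hm, k, hk, d, c, hc, a, b, e, p, q, r, hcorner, hphase⟩ := hCover δ hδ
    exact ⟨m, hm, k, hk, d, c, hc, hLift m k d c a b e p q r hcorner hphase⟩
  -- the Weyl completion family, from the border families through ladder + budget
  have hFamily : WeylCompletion := hBudget hBorder hLadder
  -- the clock-and-shift presentation (landed, 5498) and the Weyl glue (landed, 5499)
  exact weylToThesis_proof weylPresentation_proof hFamily

/-- The crux BY NAME from the registered stubs (`sorry` enters only through `stub_*`). -/
theorem Thesis_closed :
    Summit.MatrixMultiplication.MatrixMultiplication.Theses.WindowedCompletionRank.Thesis :=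
  Thesis_of stub_tropicalCoverFamily stub_toricLift stub_finiteBorderLadder stub_exponentBudget

end Summit.MatrixMultiplication.MatrixMultiplication.Cruxes.Thesis.ToricBorderWCR
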